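import Summits.Ventures.Crystal3D.Theorems.StickyWulffConstantCoaxialWallLawInPlaneSlot
import Summits.Ventures.Crystal3D.Theorems.StickyWulffConstantGenericWallFloorExitCertified
import HarnessLib

/-!
# The sharp in-plane flux `(√6/2)·sin θ` of a co-axial grain, and certified exits pay at the exit

HONEST FRAMING. Part of the venture `Summits/Ventures/Crystal3D` (cell `crystal3d-full`), helper
`--supports` the crux `CoaxialWallLaw` (stmt-Ventures-19481, `route-Ventures-StickyWulffConstant`),
REGISTERED line `WallLedgerF` (planner cf-p1 gen 16), stub `stub_coaxialTwoSlabAdhesion`.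
Inputs of the CERTIFIED co-axial general-filling rung (`…CoaxialWallLawCertifiedRung`, this seat gen 4).
Rung credit only; F-C1 not moved.

* `coaxial_sine_le_two_mul_inPlaneClass` / `exists_inPlane_slot_of_coaxial_sharp` — the BEST of the three
  in-plane classes `L u₁`, `L u₂`, `L (u₂ − u₁)` of the common frame (mutual angle `60°`; one is within
  `30°` of the tilt direction) carries `2 |⟪L v, e₃⟫| ≥ √3 · sin ∠(e₃, m)`, i.e. the line flux
  `√2 |⟪A₁ w, e₃⟫| ≥ (√6/2) · sin θ` along an in-plane, non-descending slot `w` of grain 1 (sharpens the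
  `≥ (√6/3) · sin θ` of `exists_inPlane_slot_of_coaxial`; elementary core `3p² + q² ≤ max(4p², (p±q)²)`).
* `card_exits_le_certified` — under the C12-55 row `ExactOnly 0 {w ∈ fccSlots | 0 < ⟪w, s₀⟫}` (BY NAME,
  as in lane G's chain ledger; 19480-p2's `exit_unsaturated_or_twinCap`), for any restricting predicate `Q`:
  `#(Q-exits) ≤ #(twin-capped Q-exits) + #(payers near Q-exits)` — a non-capped exit is ITSELF
  unsaturated, hence its own payer: no sharing factor `1885`.

WHAT THIS IS NOT: not the stub; the C12-55 certificate is an input, not proved here; F-C1 not moved.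
-/

noncomputable section

namespace Summit.Ventures.Crystal3D.Theorems

open Summit.Ventures.Crystal3D Finset
open Literature.MathematicalPhysics.StatisticalMechanics (fccStacking barlowStacking IsHaggSeq contactDeficiency
  triangularVec₁ triangularVec₂)
open scoped InnerProductSpace

/-! ### The sharp in-plane flux: the best of three classes at mutual angle 60° -/

/-- Elementary: for reals `p, q`, `3p² + q² ≤ max (4p², (p+q)², (p−q)²)` (as a disjunction). -/
theorem three_sq_add_sq_le_cases (p q : ℝ) :
    3 * p ^ 2 + q ^ 2 ≤ 4 * p ^ 2 ∨ 3 * p ^ 2 + q ^ 2 ≤ (p + q) ^ 2 ∨ 3 * p ^ 2 + q ^ 2 ≤ (p - q) ^ 2 := by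
  by_cases hpq : q ^ 2 ≤ p ^ 2
  · exact Or.inl (by linarith)
  push Not at hpq
  have habs : |p| < |q| := sq_lt_sq.1 hpq
  have key : 3 * p ^ 2 + q ^ 2 ≤ p ^ 2 + q ^ 2 + 2 * |p * q| := by
    rw [abs_mul]
    nlinarith [abs_nonneg p, sq_abs p, mul_le_mul_of_nonneg_left habs.le (abs_nonneg p)]
  by_cases hs : 0 ≤ p * q
  · refine Or.inr (Or.inl ?_)
    rw [abs_of_nonneg hs] at key
    nlinarith [key]
  · refine Or.inr (Or.inr ?_)
    push Not at hs
    rw [abs_of_neg hs] at key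
    nlinarith [key]

/-- From `3 S ≤ 4 x²`: `√3 · √S ≤ 2 |x|`. -/
theorem sqrt_three_mul_sqrt_le_two_abs {S x : ℝ} (h : 3 * S ≤ 4 * x ^ 2) :
    Real.sqrt 3 * Real.sqrt S ≤ 2 * |x| := by
  rw [← Real.sqrt_mul (by norm_num : (0 : ℝ) ≤ 3)]
  have h2 : (2 : ℝ) * |x| = Real.sqrt ((2 * x) ^ 2) := by
    rw [Real.sqrt_sq_eq_abs, abs_mul, abs_of_pos (by norm_num : (0 : ℝ) < 2)]
  rw [h2]
  exact Real.sqrt_le_sqrt (by nlinarith)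

/-- **The best in-plane class carries `(√3/2)·sin θ`.**  For every linear isometry `L` of `ℝ³` (axis
`m = L e₃`), one of the three in-plane classes `L u₁`, `L u₂`, `L (u₂ − u₁)` has
`2 |⟪L v, e₃⟫| ≥ √3 · √(1 − ⟪L e₃, e₃⟫²)` (three directions at mutual angle `60°`: one is within `30°` of
the tilt direction; sharp at `30°`). -/
theorem coaxial_sine_le_two_mul_inPlaneClass
    (L : EuclideanSpace ℝ (Fin 3) ≃ₗᵢ[ℝ] EuclideanSpace ℝ (Fin 3)) :
    Real.sqrt 3 * Real.sqrt (1 - ⟪L (EuclideanSpace.single (2 : Fin 3) (1 : ℝ)),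
        (EuclideanSpace.single (2 : Fin 3) (1 : ℝ))⟫_ℝ ^ 2) ≤
      2 * |⟪L (triangularVec₁ 1), EuclideanSpace.single (2 : Fin 3) (1 : ℝ)⟫_ℝ| ∨
    Real.sqrt 3 * Real.sqrt (1 - ⟪L (EuclideanSpace.single (2 : Fin 3) (1 : ℝ)),
        (EuclideanSpace.single (2 : Fin 3) (1 : ℝ))⟫_ℝ ^ 2) ≤
      2 * |⟪L (triangularVec₂ 1), EuclideanSpace.single (2 : Fin 3) (1 : ℝ)⟫_ℝ| ∨
    Real.sqrt 3 * Real.sqrt (1 - ⟪L (EuclideanSpace.single (2 : Fin 3) (1 : ℝ)),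
        (EuclideanSpace.single (2 : Fin 3) (1 : ℝ))⟫_ℝ ^ 2) ≤
      2 * |⟪L (triangularVec₂ 1 - triangularVec₁ 1), EuclideanSpace.single (2 : Fin 3) (1 : ℝ)⟫_ℝ| := by
  set e₃ : EuclideanSpace ℝ (Fin 3) := EuclideanSpace.single (2 : Fin 3) (1 : ℝ) with he₃
  set n : EuclideanSpace ℝ (Fin 3) := L.symm e₃ with hn
  have he₃L : e₃ = L n := by rw [hn, LinearIsometryEquiv.apply_symm_apply]
  have hflip : ∀ v : EuclideanSpace ℝ (Fin 3), ⟪L v, e₃⟫_ℝ = ⟪v, n⟫_ℝ := by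
    intro v; rw [he₃L, LinearIsometryEquiv.inner_map_map]
  have hnorm : ‖n‖ = 1 := by
    rw [hn, LinearIsometryEquiv.norm_map, he₃, PiLp.norm_single, norm_one]
  rw [hflip, hflip, hflip, hflip, inner_sub_left]
  obtain ⟨h₁, h₂⟩ := inner_triangularVec n
  rw [h₁, h₂]
  have he₃n : ⟪e₃, n⟫_ℝ = n 2 := by
    rw [he₃, EuclideanSpace.inner_single_left]; simp
  rw [he₃n, one_sub_sq_apply_two n hnorm]
  -- `p = n 0`, `q = √3 · n 1`
  have h3 : Real.sqrt 3 ^ 2 = 3 := Real.sq_sqrt (by norm_num)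
  have hq2 : (Real.sqrt 3 * n 1) ^ 2 = 3 * n 1 ^ 2 := by rw [mul_pow, h3]
  rcases three_sq_add_sq_le_cases (n 0) (Real.sqrt 3 * n 1) with h | h | h
  · exact Or.inl (sqrt_three_mul_sqrt_le_two_abs (by nlinarith [hq2]))
  · refine Or.inr (Or.inl (sqrt_three_mul_sqrt_le_two_abs ?_))
    have e : n 0 / 2 + Real.sqrt 3 / 2 * n 1 = (n 0 + Real.sqrt 3 * n 1) / 2 := by ring
    rw [e, div_pow]; nlinarith [hq2]
  · refine Or.inr (Or.inr (sqrt_three_mul_sqrt_le_two_abs ?_))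
    have e : n 0 / 2 + Real.sqrt 3 / 2 * n 1 - n 0 = -((n 0 - Real.sqrt 3 * n 1) / 2) := by ring
    rw [e, neg_sq, div_pow]; nlinarith [hq2]

/-- **The sharp in-plane riser slot.**  Under the co-axiality hypothesis of the crux for grain 1 there is a
slot `w` of grain 1 that is in-plane for the axis `m = L e₃`, non-descending, and carries the flux
`√2 |⟪A₁ w, e₃⟫| ≥ (√6/2) · sin ∠(e₃, m)`: `√6 · √(1 − ⟪L e₃, e₃⟫²) ≤ 2 · (√2 · |⟪A₁ w, e₃⟫|)`. -/
theorem exists_inPlane_slot_of_coaxial_sharp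
    (A₁ : EuclideanSpace ℝ (Fin 3) ≃ₗᵢ[ℝ] EuclideanSpace ℝ (Fin 3)) (t₁ : EuclideanSpace ℝ (Fin 3))
    (L : EuclideanSpace ℝ (Fin 3) ≃ₗᵢ[ℝ] EuclideanSpace ℝ (Fin 3)) (s₁ : EuclideanSpace ℝ (Fin 3))
    {σ : ℤ → ℤ} (hσ : IsHaggSeq σ)
    (hsub : (fun p => A₁ p + t₁) '' fccStacking 1 (Real.sqrt (2 / 3)) ⊆
      (fun p => L p + s₁) '' barlowStacking 1 (Real.sqrt (2 / 3)) σ) :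
    ∃ w ∈ fccSlots, ⟪A₁ w, L (EuclideanSpace.single (2 : Fin 3) (1 : ℝ))⟫_ℝ = 0 ∧
      0 ≤ ⟪A₁ w, EuclideanSpace.single (2 : Fin 3) (1 : ℝ)⟫_ℝ ∧
      Real.sqrt 6 * Real.sqrt (1 - ⟪L (EuclideanSpace.single (2 : Fin 3) (1 : ℝ)),
          EuclideanSpace.single (2 : Fin 3) (1 : ℝ)⟫_ℝ ^ 2) ≤
        2 * (Real.sqrt 2 * |⟪A₁ w, EuclideanSpace.single (2 : Fin 3) (1 : ℝ)⟫_ℝ|) := by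
  set e₃ : EuclideanSpace ℝ (Fin 3) := EuclideanSpace.single (2 : Fin 3) (1 : ℝ) with he₃
  -- a base point of the grain
  obtain ⟨w₀, hw₀⟩ : ∃ w₀, w₀ ∈ fccSlots := Finset.card_pos.1 (by rw [card_fccSlots]; norm_num)
  have hx : A₁ w₀ + t₁ ∈ (fun p => A₁ p + t₁) '' fccStacking 1 (Real.sqrt (2 / 3)) :=
    ⟨w₀, mem_fcc_of_mem_fccSlots hw₀, rfl⟩
  obtain ⟨hn₁, hn₂, hn₁₂⟩ := norm_triangularVec_one
  have hcls : ∀ v : EuclideanSpace ℝ (Fin 3), ‖v‖ = 1 → ⟪v, e₃⟫_ℝ = 0 →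
      (∃ i j : ℤ, v = (i : ℝ) • triangularVec₁ 1 + (j : ℝ) • triangularVec₂ 1) →
      ∃ w ∈ fccSlots, A₁ w = L v ∧ ⟪A₁ w, L e₃⟫_ℝ = 0 ∧ ⟪A₁ w, e₃⟫_ℝ = ⟪L v, e₃⟫_ℝ := by
    intro v hv hv3 ⟨i, j, hij⟩
    have hy := coaxial_inPlane_slot_mem A₁ t₁ L s₁ hσ hsub hx i j
    rw [← hij] at hy
    obtain ⟨w, hw, hAw⟩ := exists_slot_eq_of_mem_sub A₁ t₁ hx hy
      (by rw [add_sub_cancel_left, LinearIsometryEquiv.norm_map, hv])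
    rw [add_sub_cancel_left] at hAw
    refine ⟨w, hw, hAw, ?_, by rw [hAw]⟩
    rw [hAw, LinearIsometryEquiv.inner_map_map, hv3]
  obtain ⟨h₁3, h₂3⟩ := inner_triangularVec_e₃
  obtain ⟨a, ha, -, ha0, hae⟩ := hcls (triangularVec₁ 1) hn₁ h₁3 ⟨1, 0, by simp⟩
  obtain ⟨b, hb, -, hb0, hbe⟩ := hcls (triangularVec₂ 1) hn₂ h₂3 ⟨0, 1, by simp⟩
  obtain ⟨c, hc, -, hc0, hce⟩ := hcls (triangularVec₂ 1 - triangularVec₁ 1) hn₁₂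
    (by rw [inner_sub_left, h₁3, h₂3, sub_zero]) ⟨-1, 1, by simp [add_comm, sub_eq_add_neg]⟩
  -- the sharp tilt inequality
  have htilt := coaxial_sine_le_two_mul_inPlaneClass L
  rw [← hae, ← hbe, ← hce] at htilt
  have h6 : Real.sqrt 6 = Real.sqrt 2 * Real.sqrt 3 := by
    rw [← Real.sqrt_mul (by norm_num)]; norm_num
  have hs2 : 0 ≤ Real.sqrt 2 := Real.sqrt_nonneg 2
  -- sign flip keeps everything
  have flip : ∀ w ∈ fccSlots, ⟪A₁ w, L e₃⟫_ℝ = 0 →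
      Real.sqrt 3 * Real.sqrt (1 - ⟪L e₃, e₃⟫_ℝ ^ 2) ≤ 2 * |⟪A₁ w, e₃⟫_ℝ| →
      ∃ w' ∈ fccSlots, ⟪A₁ w', L e₃⟫_ℝ = 0 ∧ 0 ≤ ⟪A₁ w', e₃⟫_ℝ ∧
        Real.sqrt 6 * Real.sqrt (1 - ⟪L e₃, e₃⟫_ℝ ^ 2) ≤ 2 * (Real.sqrt 2 * |⟪A₁ w', e₃⟫_ℝ|) := by
    intro w hw hw0 hle
    have hle' : Real.sqrt 6 * Real.sqrt (1 - ⟪L e₃, e₃⟫_ℝ ^ 2) ≤ 2 * (Real.sqrt 2 * |⟪A₁ w, e₃⟫_ℝ|) := by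
      rw [h6, mul_assoc]
      have := mul_le_mul_of_nonneg_left hle hs2
      linarith
    by_cases hsgn : 0 ≤ ⟪A₁ w, e₃⟫_ℝ
    · exact ⟨w, hw, hw0, hsgn, hle'⟩
    · refine ⟨-w, neg_mem_fccSlots hw, ?_, ?_, ?_⟩
      · rw [map_neg, inner_neg_left, hw0, neg_zero]
      · rw [map_neg, inner_neg_left]; linarith
      · rwa [map_neg, inner_neg_left, abs_neg]
  rcases htilt with h | h | h
  · exact flip a ha ha0 h
  · exact flip b hb hb0 h
  · exact flip c hc hc0 h

/-! ### Certified exits pay for themselves -/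

open scoped Classical in
/-- **Certified restricted exits pay at the exit.**  Under the C12-55 row `ExactOnly 0 {w | 0 < ⟪w, s₀⟫}`,
for any predicate `Q`: the `u`-exits satisfying `Q` number at most the twin-capped ones plus the unsaturated
balls within contact distance three of a `Q`-exit (indeed plus the unsaturated `Q`-exits themselves). -/
theorem card_exits_le_certified {X : Finset (EuclideanSpace ℝ (Fin 3))}
    (hX : ∀ p ∈ X, ∀ q ∈ X, p ≠ q → 1 ≤ dist p q)
    {s₀ : EuclideanSpace ℝ (Fin 3)} (hs₀ : s₀ ∈ fccSlots)
    (hcert : ExactOnly 0 (fccSlots.filter fun w => 0 < ⟪w, s₀⟫_ℝ))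
    (A : EuclideanSpace ℝ (Fin 3) ≃ₗᵢ[ℝ] EuclideanSpace ℝ (Fin 3)) {u : EuclideanSpace ℝ (Fin 3)}
    (hu : u ∈ fccSlots) (Q : EuclideanSpace ℝ (Fin 3) → Prop) :
    (X.filter fun e => Q e ∧ e - A u ∈ X ∧ (∀ w ∈ fccSlots, e - A u + A w ∈ X) ∧
        ∃ v ∈ fccSlots, e + A v ∉ X).card ≤
      ((X.filter fun e => Q e ∧ e - A u ∈ X ∧ (∀ w ∈ fccSlots, e - A u + A w ∈ X) ∧
          ∃ v ∈ fccSlots, e + A v ∉ X).filter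
        fun e => ∃ n : EuclideanSpace ℝ (Fin 3), ‖n‖ = 1 ∧
          (∀ w ∈ fccSlots, ⟪A w, n⟫_ℝ = 0 ∨ ⟪A w, n⟫_ℝ = Real.sqrt (2 / 3) ∨ ⟪A w, n⟫_ℝ = -Real.sqrt (2 / 3)) ∧
          ⟪A u, n⟫_ℝ = Real.sqrt (2 / 3) ∧
          (∀ w ∈ fccSlots, ⟪A w, n⟫_ℝ ≤ 0 → e + A w ∈ X) ∧
          (∀ w ∈ fccSlots, 0 < ⟪A w, n⟫_ℝ → e + A w ∉ X ∧ e - A w + (2 * ⟪A w, n⟫_ℝ) • n ∈ X)).card +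
      (X.filter fun y => (X.filter fun q => dist y q = 1).card ≠ 12 ∧
        ∃ e ∈ X, (Q e ∧ e - A u ∈ X ∧ (∀ w ∈ fccSlots, e - A u + A w ∈ X) ∧ ∃ v ∈ fccSlots, e + A v ∉ X) ∧
          (y = e ∨ dist e y = 1 ∨ (∃ z ∈ X, dist e z = 1 ∧ dist z y = 1) ∨
            ∃ z ∈ X, ∃ z' ∈ X, dist e z = 1 ∧ dist z z' = 1 ∧ dist z' y = 1)).card := by
  set EX := X.filter fun e => Q e ∧ e - A u ∈ X ∧ (∀ w ∈ fccSlots, e - A u + A w ∈ X) ∧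
    ∃ v ∈ fccSlots, e + A v ∉ X with hEX
  set capped : EuclideanSpace ℝ (Fin 3) → Prop := fun e => ∃ n : EuclideanSpace ℝ (Fin 3), ‖n‖ = 1 ∧
    (∀ w ∈ fccSlots, ⟪A w, n⟫_ℝ = 0 ∨ ⟪A w, n⟫_ℝ = Real.sqrt (2 / 3) ∨ ⟪A w, n⟫_ℝ = -Real.sqrt (2 / 3)) ∧
    ⟪A u, n⟫_ℝ = Real.sqrt (2 / 3) ∧
    (∀ w ∈ fccSlots, ⟪A w, n⟫_ℝ ≤ 0 → e + A w ∈ X) ∧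
    (∀ w ∈ fccSlots, 0 < ⟪A w, n⟫_ℝ → e + A w ∉ X ∧ e - A w + (2 * ⟪A w, n⟫_ℝ) • n ∈ X) with hcapped
  set U := X.filter fun y => (X.filter fun q => dist y q = 1).card ≠ 12 ∧
    ∃ e ∈ X, (Q e ∧ e - A u ∈ X ∧ (∀ w ∈ fccSlots, e - A u + A w ∈ X) ∧ ∃ v ∈ fccSlots, e + A v ∉ X) ∧
      (y = e ∨ dist e y = 1 ∨ (∃ z ∈ X, dist e z = 1 ∧ dist z y = 1) ∨
        ∃ z ∈ X, ∃ z' ∈ X, dist e z = 1 ∧ dist z z' = 1 ∧ dist z' y = 1) with hU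
  -- a non-capped exit is its own payer
  have hsub : EX.filter (fun e => ¬ capped e) ⊆ U := by
    intro e he
    rw [mem_filter] at he
    obtain ⟨heEX, hnc⟩ := he
    rw [hEX, mem_filter] at heEX
    obtain ⟨heX, hQ, hdX, hfull, hv⟩ := heEX
    rcases exit_unsaturated_or_twinCap hX hs₀ hcert A hu hdX hfull hv with h11 | hcap
    · rw [hU, mem_filter]
      exact ⟨heX, by omega, e, heX, ⟨hQ, hdX, hfull, hv⟩, Or.inl rfl⟩
    · exact absurd hcap hnc
  have h1 : (EX.filter fun e => ¬ capped e).card ≤ U.card := card_le_card hsub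
  have h2 : EX.card = (EX.filter capped).card + (EX.filter fun e => ¬ capped e).card :=
    (card_filter_add_card_filter_not (s := EX) capped).symm
  show EX.card ≤ (EX.filter capped).card + U.card
  omega

end Summit.Ventures.Crystal3D.Theorems

end
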